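import Summits.AtomisticToContinuum.HydrodynamicLimit.Theorems.ImplosionDichotomyDiluteSelfConsistencyShearFamily

/-!
# `DiluteSelfConsistency` along every isochoric slab-steady flow (stmt-3091)

Support lemmas for the crux `ImplosionDichotomy.DiluteSelfConsistency` (stmt-AtomisticToContinuum-3091), line `birth`
(rev c2), Case I: the bounded-family principle applied to the family of ISOTHERMAL SLAB-STEADY PROFILES
`(a₀, θ₀, u₀) = (c, ϑ, U)` — `c, ϑ > 0` constants, `U` smooth, depending only on the coordinates in a set `S` of directions
and with vanishing components along `S` (`∀ i ∈ S, U x i = 0`). Examples: `S = {1}` parallel shear flows `U(x₁) ⊥ e₁`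
(`ImplosionDichotomyDiluteSelfConsistencyShearFamily.lean`); `S = {0, 1}` unidirectional flows `w(x₀, x₁) e₂` with an
arbitrary smooth two-dimensional pattern `w`; `S = ∅` forces `U` constant (uniform profiles). For such `U`,
`div U = 0` and `(U·∇)U = 0`, so `(1, U, ϑ)` is a stationary classical hard-sphere-Euler solution for every `σ`, `T`
(`isHardSphereEulerSolution_slabSteady`): along `i ∉ S` nothing varies, along `i ∈ S` nothing is transported.

* `partialDeriv_eq_zero_of_translate_invariant` — a field invariant under translations along `eᵢ` has `∂ᵢ = 0`.
* `isHardSphereEulerSolution_slabSteady`, `slabSteady_boundedGlobalFamily`.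
* `diluteSelfConsistencyHoldsAt_slabSteady` (registered sub-goal) — the crux's inner clause at every such profile.

prover-line-stmt-AtomisticToContinuum-3091-c2-0 (line `birth`, rev c2).
-/

noncomputable section

namespace Summit.AtomisticToContinuum.HydrodynamicLimit.Theorems

open MeasureTheory Filter Set Topology
open Literature.MathematicalPhysics.KineticTheory Literature.Analysis.FluidPDE
open Literature.Analysis.FunctionSpaces
open scoped ContDiff

namespace DiluteSelfConsistencySlabSteady

open PolynomialCompressionPDE (admissible_iff_data)
open PolynomialCompressionConstantProfiles (rhoLim_const_eq_one)
open DiluteSelfConsistencyShearFamily (isSmoothSpaceTimeOn_static)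

variable {U : T3 → V3} {S : Set (Fin 3)}

/-- A field on `𝕋³` invariant under all translations along `eᵢ` has vanishing `i`-th partial derivative. [folklore] -/
theorem partialDeriv_eq_zero_of_translate_invariant {F : Type*} [NormedAddCommGroup F] [NormedSpace ℝ F]
    {G : T3 → F} {i : Fin 3} (h : ∀ (x : T3) (s : ℝ), G (x + Torus.proj (s • EuclideanSpace.single i (1 : ℝ))) = G x)
    (x : T3) : Torus.partialDeriv i G x = 0 := by
  unfold Torus.partialDeriv Torus.lineDeriv
  simp_rw [h]
  exact deriv_const 0 _

/-- Translating along `eᵢ` does not change the coordinates `j ≠ i`. [folklore] -/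
theorem coord_translate_of_ne (x : T3) (s : ℝ) {i j : Fin 3} (hj : j ≠ i) :
    (x + Torus.proj (s • EuclideanSpace.single i (1 : ℝ))) j = x j := by
  rw [Pi.add_apply, Torus.proj_apply]
  simp [hj]

/-- A field depending only on the coordinates in `S` is invariant under translations along `eᵢ`, `i ∉ S`. [folklore] -/
theorem translate_invariant_of_dep (hdep : ∀ x y : T3, (∀ j ∈ S, x j = y j) → U x = U y) {i : Fin 3} (hi : i ∉ S)
    (x : T3) (s : ℝ) : U (x + Torus.proj (s • EuclideanSpace.single i (1 : ℝ))) = U x :=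
  hdep _ _ fun _ hj => coord_translate_of_ne x s (fun h => hi (h ▸ hj))

/-- **Every isothermal slab-steady flow is a classical solution**, for every `σ`, `T` and temperature `ϑ > 0`: `ρ ≡ 1`,
`θ ≡ ϑ`, `u = U` with `U` smooth, depending only on the coordinates in `S` and orthogonal to every `eᵢ`, `i ∈ S`. Along
`i ∉ S` every field is translation invariant (`∂ᵢ = 0`); along `i ∈ S` the transported quantity carries the factor
`U x i = 0`; the pressure `ϑ Z(σ³)` is constant. [folklore] -/
theorem isHardSphereEulerSolution_slabSteady (hU : Torus.IsSmooth U)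
    (hdep : ∀ x y : T3, (∀ j ∈ S, x j = y j) → U x = U y) (hS : ∀ x, ∀ i ∈ S, U x i = 0) (σ T : ℝ) {ϑ : ℝ}
    (hϑ : 0 < ϑ) : IsHardSphereEulerSolution σ T (fun _ _ => 1) (fun _ x => U x) (fun _ _ => ϑ) where
  smooth_density := contDiffOn_const
  smooth_velocity := isSmoothSpaceTimeOn_static hU _
  smooth_temperature := contDiffOn_const
  density_pos _ _ _ := one_pos
  temperature_pos _ _ _ := hϑ
  mass t _ x := by
    have h0 : Torus.timeDerivWithin (Ico 0 T) (fun (_ : ℝ) (_ : T3) => (1 : ℝ)) t x = 0 := by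
      simp [Torus.timeDerivWithin]
    rw [h0, zero_add, Torus.divergence]
    refine Finset.sum_eq_zero fun i _ => ?_
    by_cases hi : i ∈ S
    · have e : (fun y : T3 => ((1 : ℝ) • U y) i) = fun _ => (0 : ℝ) := by
        funext y; simp [hS y i hi]
      rw [e]
      simp [Torus.partialDeriv, Torus.lineDeriv]
    · exact partialDeriv_eq_zero_of_translate_invariant
        (fun y s => by simp only [one_smul]; rw [translate_invariant_of_dep hdep hi]) x
  momentum t _ x := by
    have h0 : Torus.timeDerivWithin (Ico 0 T) (fun (_ : ℝ) (y : T3) => (1 : ℝ) • U y) t x = 0 := by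
      simp [Torus.timeDerivWithin]
    have hp : Torus.gradient (fun _ : T3 => hsPressure σ 1 ϑ) x = 0 := by
      unfold Torus.gradient Torus.liftAt
      exact gradient_fun_const 0 _
    rw [h0, zero_add, hp, add_zero]
    refine Finset.sum_eq_zero fun i _ => ?_
    by_cases hi : i ∈ S
    · have e : (fun y : T3 => ((1 : ℝ) * U y i) • U y) = fun _ => (0 : V3) := by
        funext y; simp [hS y i hi]
      rw [e]
      simp [Torus.partialDeriv, Torus.lineDeriv]
    · exact partialDeriv_eq_zero_of_translate_invariant
        (fun y s => by rw [translate_invariant_of_dep hdep hi]) x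
  energy t _ x := by
    have h0 : Torus.timeDerivWithin (Ico 0 T)
        (fun (_ : ℝ) (y : T3) => totalEnergyDensity 1 (U y) ϑ) t x = 0 := by
      simp [Torus.timeDerivWithin]
    rw [h0, zero_add, Torus.divergence]
    refine Finset.sum_eq_zero fun i _ => ?_
    by_cases hi : i ∈ S
    · have e : (fun y : T3 => ((totalEnergyDensity 1 (U y) ϑ + hsPressure σ 1 ϑ) • U y) i) = fun _ => (0 : ℝ) := by
        funext y; simp [hS y i hi]
      rw [e]
      simp [Torus.partialDeriv, Torus.lineDeriv]
    · exact partialDeriv_eq_zero_of_translate_invariant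
        (fun y s => by rw [translate_invariant_of_dep hdep hi]) x

/-- **Every isothermal slab-steady flow is a σ-uniformly bounded global family for its own pinned data**: for the
profiles `(c, ϑ, U)` and every `σ` below the statics threshold, on every horizon the stationary flow `(1, U, ϑ)` is a
classical solution with the pinned data (`rhoLim (profileOf c) σ ≡ 1`) and density `≤ 1`. [folklore] -/
theorem slabSteady_boundedGlobalFamily (hU : Torus.IsSmooth U)
    (hdep : ∀ x y : T3, (∀ j ∈ S, x j = y j) → U x = U y) (hS : ∀ x, ∀ i ∈ S, U x i = 0) {c ϑ : ℝ} (hc : 0 < c)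
    (hϑ : 0 < ϑ) :
    ∃ σ₁ : ℝ, 0 < σ₁ ∧ ∀ σ : ℝ, 0 < σ → σ < σ₁ → ∀ T : ℝ, ∃ (ρ₁ θ₁ : ℝ → T3 → ℝ) (u₁ : ℝ → T3 → V3),
      IsHardSphereEulerSolution σ T ρ₁ u₁ θ₁ ∧
        ρ₁ 0 = rhoLim (profileOf (fun _ : T3 => c) continuous_const fun _ => hc) σ ∧
        u₁ 0 = U ∧ θ₁ 0 = (fun _ => ϑ) ∧ ∀ t ∈ Ico 0 T, ∀ x, ρ₁ t x ≤ 1 := by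
  obtain ⟨σ₁, hσ₁, -, G⟩ := admissible_iff_data (a₀ := fun _ : T3 => c) (θ₀ := fun _ => ϑ) (u₀ := U)
    continuous_const continuous_const hU.continuous (fun _ => hc) (fun _ => hϑ)
  refine ⟨σ₁, hσ₁, fun σ hσ hσlt T => ⟨fun _ _ => 1, fun _ _ => ϑ, fun _ x => U x,
    isHardSphereEulerSolution_slabSteady hU hdep hS σ T hϑ, ?_, rfl, rfl, fun _ _ _ => le_rfl⟩⟩
  obtain ⟨hSD, -⟩ := G σ hσ hσlt
  funext y
  exact (rhoLim_const_eq_one hc hSD y).symm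

end DiluteSelfConsistencySlabSteady

/-- **`DiluteSelfConsistency` HOLDS AT EVERY ISOTHERMAL SLAB-STEADY PROFILE.** For every set `S` of directions, every
smooth velocity field `U` on `𝕋³` depending only on the coordinates in `S` and orthogonal to every `eᵢ`, `i ∈ S`
(parallel shear flows `U(x₁) ⊥ e₁`, unidirectional flows `w(x₀, x₁) e₂`, …), all constants `c, ϑ > 0` and every level
`η > 0` there is `σ₀ > 0` with `DiluteSelfConsistencyHoldsAt η c ϑ U σ₀`: every classical hard-sphere-Euler solution on
`[0, T)` tied at `t = 0` to the local Gibbs laws of `(c, U, ϑ)` IS the stationary flow `(1, U, ϑ)`, of packing `σ³ < η`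
(bounded-family principle + uniqueness in the whole typed class). [folklore] -/
theorem diluteSelfConsistencyHoldsAt_slabSteady :
    ∀ (S : Set (Fin 3)) (U : T3 → V3), Torus.IsSmooth U → (∀ x y : T3, (∀ j ∈ S, x j = y j) → U x = U y) →
      (∀ x, ∀ i ∈ S, U x i = 0) → ∀ (c ϑ : ℝ), 0 < c → 0 < ϑ → ∀ η : ℝ, 0 < η →
        ∃ σ₀ : ℝ, 0 < σ₀ ∧ DiluteSelfConsistencyHoldsAt η (fun _ => c) (fun _ => ϑ) U σ₀ := by
  intro S U hU hdep hS c ϑ hc hϑ η hη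
  obtain ⟨σ₁, hσ₁, hfam⟩ := DiluteSelfConsistencySlabSteady.slabSteady_boundedGlobalFamily hU hdep hS hc hϑ
  exact DiluteSelfConsistencyBoundedFamilies.holdsAt_of_boundedGlobalFamily continuous_const continuous_const
    hU.continuous (fun _ => hc) (fun _ => hϑ) hσ₁ hfam hη

end Summit.AtomisticToContinuum.HydrodynamicLimit.Theorems

end
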